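import Mathlib

/-!
# Sketch — crux-ideate stmt-HodgeConjecture-15067 (TwinTransportRMPicardTwo), ideator 2, round 1

First lemmas for the idea cards `zeta8-double-quadric-anchor` and `dihedral-d8-tower`.

* `units_add_inv_sq_eq_two` : in any ring, an invertible `σ` with `σ⁴ = -1` gives
  `(σ + σ⁻¹)² = 2` — the real multiplication `e = f* + (f*)⁻¹` of an order-8 purely
  non-symplectic automorphism squares to `2` on the `ζ₈`-isotypic part.
* `selfAdjoint_add_inv`, `twoSimilitude_add_inv` : for an isometry `σ` of a bilinear form with
  two-sided inverse `τ` and `(σ + τ)∘(σ + τ) = 2`, the endomorphism `e = σ + τ` is self-adjoint and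
  a 2-similitude — exactly the hypothesis shape `e (e x) = 2 • x`, and the "halving/doubling"
  clause (H) of the crux with `S″ = S`, `Ψ|_T = e`.
* `zeta8Gram_*` : the certificate that `U ⊕ U(2)` carries a fixed-point-free `ζ₈`-structure:
  on `ℤ[ζ₈] = ℤ⁴` (basis `1, ζ, ζ², ζ³`) the form `b(x,y) = tr(√2·x·ȳ)/4` has Gram matrix `G`
  (`G i j = c (i - j)`, `c 0 = 0, c (±1) = 1, c (±2) = 0, c (±3) = -1`), multiplication by `ζ₈` is
  the matrix `C` with `C⁴ = -1` and `Cᵀ G C = G`, and `Pᵀ G P = U ⊕ U(2)` for a unimodular `P`.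
  (So `T = U ⊕ U(2) ⊕ E₈²` admits the order-8 isometry used by the anchor family; `E₈ = D₄² + glue`
  with `D₄ = 𝔭₂ ⊂ ℤ[ζ₈]` carries `(ζ₈, ζ₈)`.)
-/

set_option linter.dupNamespace false

namespace Summit.HodgeConjecture.HodgeConjecture.Cruxes.TwinTransportRMPicardTwo.Zeta8Anchor

/-! ## `σ⁴ = -1 ⟹ (σ + σ⁻¹)² = 2` -/

/-- In any ring, a unit `u` with `u⁴ = -1` satisfies `(u + u⁻¹)² = 2`
(`ζ₈ + ζ₈⁻¹ = √2`, stated multiplicatively; no commutativity needed beyond `u u⁻¹ = u⁻¹ u`). -/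
theorem units_add_inv_sq_eq_two {R : Type*} [Ring R] (u : Rˣ) (h : (u : R) ^ 4 = -1) :
    ((u : R) + (↑u⁻¹ : R)) ^ 2 = 2 := by
  set a : R := (u : R) with ha
  set b : R := (↑u⁻¹ : R) with hb
  have hab : a * b = 1 := by simp [ha, hb]
  have hba : b * a = 1 := by simp [ha, hb]
  -- b² a⁴ = a², and a⁴ = -1, so b² = -a²
  have hb2a4 : b * b * (a * a * (a * a)) = a * a := by
    have : b * b * (a * a * (a * a)) = b * (b * a) * a * (a * a) := by noncomm_ring
    rw [this, hba, mul_one, hba, one_mul]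
  have ha4 : a * a * (a * a) = -1 := by
    have : a ^ 4 = a * a * (a * a) := by noncomm_ring
    rw [← this]; exact h
  have hb2 : b * b = -(a * a) := by
    have := hb2a4
    rw [ha4] at this
    -- b*b*(-1) = a*a
    have h' : -(b * b) = a * a := by simpa using this
    calc b * b = -(-(b * b)) := by rw [neg_neg]
      _ = -(a * a) := by rw [h']
  calc (a + b) ^ 2 = a * a + a * b + b * a + b * b := by noncomm_ring
    _ = a * a + 1 + 1 + -(a * a) := by rw [hab, hba, hb2]
    _ = 1 + 1 := by abel
    _ = 2 := one_add_one_eq_two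

/-! ## `e = σ + σ⁻¹` is self-adjoint and a 2-similitude -/

section Bilinear

variable {K V : Type*} [Field K] [AddCommGroup V] [Module K V]

/-- If `σ` is an isometry of `B` with two-sided inverse `τ` (also an isometry), then `e := σ + τ`
is `B`-self-adjoint: `B (e x) y = B x (e y)`. (Zarhin: totally real endomorphisms of a K3-type
Hodge structure are self-adjoint; here it is elementary.) -/
theorem selfAdjoint_add_inv (B : V →ₗ[K] V →ₗ[K] K) (σ τ : V →ₗ[K] V)
    (hστ : ∀ x, σ (τ x) = x) (hτσ : ∀ x, τ (σ x) = x)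
    (hσ : ∀ x y, B (σ x) (σ y) = B x y) (hτ : ∀ x y, B (τ x) (τ y) = B x y) (x y : V) :
    B ((σ + τ) x) y = B x ((σ + τ) y) := by
  simp only [LinearMap.add_apply, map_add, LinearMap.add_apply]
  have h1 : B (σ x) y = B x (τ y) := by
    conv_lhs => rw [← hστ y]
    rw [hσ]
  have h2 : B (τ x) y = B x (σ y) := by
    conv_lhs => rw [← hτσ y]
    rw [hτ]
  rw [h1, h2, add_comm]

/-- With the same hypotheses and `e (e x) = 2 • x` (from `σ⁴ = -1`, previous lemma), `e = σ + τ`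
doubles the form: `B (e x) (e y) = 2 * B x y` — i.e. `Ψ := e` on `T(S)` is a 2-similitude and
`Ψ⁻¹ = e/2` halves it, clause (H) of the crux with `S″ = S`. -/
theorem twoSimilitude_add_inv (B : V →ₗ[K] V →ₗ[K] K) (σ τ : V →ₗ[K] V)
    (hστ : ∀ x, σ (τ x) = x) (hτσ : ∀ x, τ (σ x) = x)
    (hσ : ∀ x y, B (σ x) (σ y) = B x y) (hτ : ∀ x y, B (τ x) (τ y) = B x y)
    (he2 : ∀ x, (σ + τ) ((σ + τ) x) = (2 : K) • x) (x y : V) :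
    B ((σ + τ) x) ((σ + τ) y) = 2 * B x y := by
  rw [selfAdjoint_add_inv B σ τ hστ hτσ hσ hτ x ((σ + τ) y), he2, map_smul, smul_eq_mul]

end Bilinear

/-! ## The `ζ₈`-structure on `U ⊕ U(2)` (certificate) -/

/-- Gram matrix of `b(x,y) = tr_{ℚ(ζ₈)/ℚ}(√2·x·ȳ)/4` on the basis `1, ζ₈, ζ₈², ζ₈³` of `ℤ[ζ₈]`. -/
def zeta8Gram : Matrix (Fin 4) (Fin 4) ℤ :=
  !![0, 1, 0, -1;
     1, 0, 1, 0;
     0, 1, 0, 1;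
    -1, 0, 1, 0]

/-- Multiplication by `ζ₈` on `ℤ[ζ₈] = ⊕ ℤ ζ₈ⁱ` (`ζ⁴ = -1`). -/
def zeta8Mul : Matrix (Fin 4) (Fin 4) ℤ :=
  !![0, 0, 0, -1;
     1, 0, 0, 0;
     0, 1, 0, 0;
     0, 0, 1, 0]

/-- Change of basis to `e₀, e₁, e₀ - e₂, -(e₁ + e₃)`. -/
def zeta8Basis : Matrix (Fin 4) (Fin 4) ℤ :=
  !![1, 0, 1, 0;
     0, 1, 0, -1;
     0, 0, -1, 0;
     0, 0, 0, -1]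

/-- `U ⊕ U(2)`. -/
def hyperbolicUU2 : Matrix (Fin 4) (Fin 4) ℤ :=
  !![0, 1, 0, 0;
     1, 0, 0, 0;
     0, 0, 0, 2;
     0, 0, 2, 0]

/-- `ζ₈` acts with `ζ⁴ = -1` (so fixed-point-free: characteristic polynomial `x⁴ + 1`). -/
theorem zeta8Mul_pow_four : zeta8Mul ^ 4 = -1 := by decide

/-- Multiplication by `ζ₈` is an isometry of the trace form. -/
theorem zeta8Mul_isometry : zeta8Mul.transpose * zeta8Gram * zeta8Mul = zeta8Gram := by decide

/-- The trace form is even, of discriminant `4`, and isometric over `ℤ` to `U ⊕ U(2)`: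
`Pᵀ G P = U ⊕ U(2)` with `P` unimodular. Hence `U ⊕ U(2)` — and with `E₈² = (D₄²+glue)²`,
the lattice `T = U ⊕ U(2) ⊕ E₈²` of the `Pic = U(2)` maximal RM-√2 family — carries an order-8
isometry `σ` with `σ⁴ = -1`; `ζ₈` swaps the two `q = 0` classes of the discriminant group, which is
why the automorphism `f` of the anchor family must swap the two rulings of `ℙ¹ × ℙ¹`. -/
theorem zeta8Gram_equiv_UU2 :
    zeta8Basis.transpose * zeta8Gram * zeta8Basis = hyperbolicUU2 ∧ zeta8Basis.det = 1 := by
  refine ⟨by decide, ?_⟩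
  decide


/-! ## Group theory of the dihedral tower (card `dihedral-d8-tower`)

`D₈ = ⟨σ, τ | σ⁸ = τ² = 1, τστ = σ⁻¹⟩` (Mathlib `DihedralGroup 8`, order 16): the rotation has
order 8 with `σ⁴` central, EVERY element outside `⟨σ⟩` is an involution conjugating `σ` to `σ⁻¹`
(so the Hecke element `σ + σ⁻¹` descends to `X = X̃/τ` for any reflection `τ`), whereas in the
generalized quaternion group `Q₁₆` (Mathlib `QuaternionGroup 4`) the only involution is central —
the two extensions of `D₄` by `ℤ/2` containing `ℤ/8` behave oppositely for the quotient `X̃/τ`. -/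

section Dihedral

open DihedralGroup in
/-- In `D₈` the rotation `r 1` has order 8, `(r 1)⁴ = r 4` is central, and every reflection
`sr i` is an involution with `(sr i) (r 1) (sr i) = (r 1)⁻¹`. -/
theorem d8_rotation_reflection :
    (r 1 : DihedralGroup 8) ^ 8 = 1 ∧ (r 1 : DihedralGroup 8) ^ 4 ≠ 1 ∧
    (∀ g : DihedralGroup 8, g * (r 1) ^ 4 = (r 1) ^ 4 * g) ∧
    (∀ i : ZMod 8, (sr i : DihedralGroup 8) * sr i = 1 ∧
      (sr i : DihedralGroup 8) * r 1 * sr i = (r 1)⁻¹) := by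
  decide

open QuaternionGroup in
/-- In `Q₁₆` every involution is the central element `a 4`: no reflection to quotient by. -/
theorem q16_involutions_central :
    ∀ g : QuaternionGroup 4, g * g = 1 → g = a 0 ∨ g = a 4 := by
  decide

end Dihedral

end Summit.HodgeConjecture.HodgeConjecture.Cruxes.TwinTransportRMPicardTwo.Zeta8Anchor
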